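import Summits.QuantumFields.YangMills.Theorems.VirialFluxGapFixVarSum
import Summits.QuantumFields.YangMills.Theorems.VirialFluxGapCentralFieldSeamDerivative
import Summits.QuantumFields.YangMills.Theorems.VirialFluxGapCentralFieldPlainDerivative
import Summits.QuantumFields.YangMills.Theorems.VirialFluxGapCentralFieldTraceBounds
import Summits.QuantumFields.YangMills.Theorems.VirialFluxGapCentralWindowSmallness
import Summits.QuantumFields.YangMills.Theorems.VirialFluxGapCentralFieldSmooth
import HarnessLib

/-!
# Route `VirialFluxGap` (YangMills): (P3) FOR THE EXPLICIT CENTRAL FIELD ON THE CLOSED CENTRAL WINDOW — the divergence of `centralCoeff σ σ₄` in the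
# standard `X_fix` frame is `≤ 18L⁴ − ½` at every `X_fix` point with the four regularity masses `≤ ρ²`, `ρ ≤ 1/5`, and `F_fix ≤ t_C ≤ (4096·L⁴)⁻¹`

Toward the deciding crux `VirialFluxGap.PeriodicSoftness` (item stmt-QuantumFields-24141): clause (P3) of the central field package consumed by
✓`FrameHessian.periodicSoftness_of_signPlug` ∕ ✓`periodicSoftness_of_centralField`, for the EXPLICIT field `Φ = centralCoeff L` (w3 g59 ✓`CentralFieldDefs`),
stated VERBATIM in the package letters (`x : X_fix` glued into a ring history by ✓`glue`, masses `1 − Re(q)²` of the three wrap representatives and of the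
seam root, `ringDeficit ≤ t_C`).  This file is the composition of pieces already in the tree:

* the per-variable traces of the explicit field — ✓`centralDiv_wrap_eq` (wrap-block slots), ✓`centralDiv_seam_eq` (seam slots), ✓`centralDiv_plain_le` (plain
  slots `≤ 3`) — and the sign-free numerical bound ✓`central_trace_le` (`≤ 3 − (3/2)/N + 3ρ′²/N` once `|Im q|², |z|² ≤ ρ′² ≤ ½`);
* the window smallness ✓`im_wrap_le_of_window` ∕ `im_seam_le_of_window` ∕ `blockIm_le_of_window` ∕ `seamIm_le_of_window` (`|Im q_v|, |z_B| ≤ ρ + 16L²√F₀` in comb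
  gauge), so `ρ′ := ρ + 16L²√F₀` works, and `ρ′ ≤ 1/5 + 1/4 = 9/20`, `ρ′² = 81/400 ≤ 5/24` on the window `ρ ≤ 1/5`, `F₀ ≤ (4096L⁴)⁻¹`;
* differentiability of the slot coordinates from w2 g52 ✓`contDiff_centralDir_pauliCoord`;
* the bookkeeping ✓`FixFrame.centralDiv_le_budget` (w2 g52): per-slot bounds ⇒ total `≤ 18L⁴ − 3 + 12ρ′² ≤ 18L⁴ − ½`.

Results: `differentiableAt_centralDir_pauliCoord`; ★ `centralDiv_wrap_le_of_window`, ★ `centralDiv_seam_le_of_window` (per-slot bounds on the window at a ring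
history in comb gauge); ★★ `centralDiv_le_of_window` (the total at a ring history in comb gauge); ★★★ `central_divergence_window` — (P3) in package shape:
for `σ_k, σ₄ = ±1`, `0 ≤ ρ ≤ 1/5`, `t_C ≤ (4096·L⁴)⁻¹`, at every `x : X_fix` with masses `≤ ρ²` and `F_fix x ≤ t_C`,
`Σ_va ∂_{fixFrameStd va}(centralCoeff L σ σ₄ va)(M_x) ≤ 18L⁴ − ½`.  NO sign hypothesis (`½ ≤ σ·Re q`) is needed for (P3).

HONEST LABEL: one hypothesis ((P3)) of a CONDITIONAL assembly discharged for the explicit field by composing landed lemmas; (P2) (the drive) remains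
(w3 lineage); nothing is closed; ⟨24141⟩ and ⟨22884⟩ remain OPEN; the Yang–Mills mass gap is NOT proved; no summit is proved by a line.  THEOREMS ONLY
(0 `def`, 0 `sorry`), standard axioms.  Width seat `ym-line-sfw-p2-w2` g53 (cell ym-idea-1, free hands; own crux ⟨22884⟩ has no free stub),
`--supports stmt-QuantumFields-24141`.
References: [cite: CosteEtAl1985] (central torons ∕ zero-mode quartic); [cite: Luscher1983, §2]; [folklore].
-/

set_option autoImplicit false

noncomputable section

open scoped Matrix BigOperators ContDiff Topology Quaternion
open Literature.MathematicalPhysics.QuantumFieldTheory hiding SU2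
open Literature.MathematicalPhysics.QuantumLattice

namespace Summit.QuantumFields.YangMills.Theorems.VirialFluxGap.CentralField

open Summit.QuantumFields.YangMills.Theorems.FemtoTransferGap
open Summit.QuantumFields.YangMills.Theorems.FemtoTransferGap.TT
open Summit.QuantumFields.YangMills.Theorems.FemtoTransferGap.TwoLattice
open Summit.QuantumFields.YangMills.Theorems.FemtoTransferGap.TwoLattice.Flat
open Summit.QuantumFields.YangMills.Theorems.VirialFluxGap.RingDeficit
open Summit.QuantumFields.YangMills.Theorems.VirialFluxGap.FrameDerivative
open Summit.QuantumFields.YangMills.Theorems.VirialFluxGap.FrameHessian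
open Summit.QuantumFields.YangMills.Theorems.VirialFluxGap.FixFrame
open Summit.QuantumFields.YangMills.Theorems.VirialFluxGap.CentralCoercivity

variable {L : ℕ} [NeZero L]

open scoped Matrix.Norms.Frobenius

/-! ## §1 Differentiability of the slot coordinates; window arithmetic -/

/-- Every half-Pauli coordinate of every slot of the explicit central direction (constant signs) is differentiable at every point
(from w2's ✓`contDiff_centralDir_pauliCoord`) — the `hdiff` clause of ✓`centralDiv_wrap_eq` ∕ `centralDiv_seam_eq` ∕ `centralDiv_plain_le`. [folklore] -/
theorem differentiableAt_centralDir_pauliCoord (σ : Fin 3 → ℝ) (σ₄ : ℝ) (w : (Fin (2 * L - 1 + 1) × Edge 3 L) ⊕ Site 3 L) (a : Fin 3)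
    (M : (Fin (2 * L - 1 + 1) → Edge 3 L → Matrix (Fin 2) (Fin 2) ℂ) × (Site 3 L → Matrix (Fin 2) (Fin 2) ℂ)) :
    DifferentiableAt ℝ (fun M' => pauliCoord (centralDir L σ σ₄ M' w) a) M :=
  (contDiff_centralDir_pauliCoord (L := L) (s := fun _ => σ) (s₄ := fun _ => σ₄) (fun _ => contDiff_const) contDiff_const w a).differentiable
    (by simp) M

omit [NeZero L] in
/-- Window arithmetic: `F ≤ (4096·L⁴)⁻¹ ⇒ 16·L²·√F ≤ 1/4` (`L ≥ 1`). [folklore] -/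
theorem sixteen_sq_sqrt_le {Lr F : ℝ} (hL : 1 ≤ Lr) (hF : F ≤ (4096 * Lr ^ 4)⁻¹) : 16 * Lr ^ 2 * Real.sqrt F ≤ 1 / 4 := by
  have hL2 : 0 < Lr ^ 2 := by positivity
  have h1 : Real.sqrt F ≤ Real.sqrt ((4096 * Lr ^ 4)⁻¹) := Real.sqrt_le_sqrt hF
  have h2 : Real.sqrt ((4096 * Lr ^ 4)⁻¹) = (64 * Lr ^ 2)⁻¹ := by
    rw [show (4096 * Lr ^ 4 : ℝ) = (64 * Lr ^ 2) ^ 2 by ring, Real.sqrt_inv, Real.sqrt_sq (by positivity)]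
  rw [h2] at h1
  calc 16 * Lr ^ 2 * Real.sqrt F ≤ 16 * Lr ^ 2 * (64 * Lr ^ 2)⁻¹ := mul_le_mul_of_nonneg_left h1 (by positivity)
    _ = 1 / 4 := by field_simp; ring

omit [NeZero L] in
/-- Window arithmetic: `0 ≤ ρ ≤ 1/5` and `16L²√F ≤ 1/4` give `ρ′ := ρ + 16L²√F ≤ 9/20` and `(9/20)² ≤ 5/24`. [folklore] -/
theorem rho_prime_sq_le {ρ d : ℝ} (hρ5 : ρ ≤ 1 / 5) (hd : d ≤ 1 / 4) : ρ + d ≤ 9 / 20 ∧ ((9 : ℝ) / 20) ^ 2 ≤ 5 / 24 :=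
  ⟨by linarith, by norm_num⟩

/-! ## §2 Per-slot bounds on the window (ring histories in comb gauge) -/

/-- The unit-norm identity in the letters of ✓`central_trace_le`: `Re(q)² + |Im q|² = 1`. [folklore] -/
theorem re_sq_add_imVec_sq (U : SU2) :
    (su2Quat U).re ^ 2 + ((imVec (su2Quat U) 0) ^ 2 + (imVec (su2Quat U) 1) ^ 2 + (imVec (su2Quat U) 2) ^ 2) = 1 := by
  obtain ⟨e0, e1, e2⟩ := imVec_apply (su2Quat U)
  have h1 : Quaternion.normSq (su2Quat U) = 1 := normSq_su2Quat U
  rw [Quaternion.normSq_def'] at h1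
  rw [e0, e1, e2]
  nlinarith [h1]

/-- ★ **Wrap-block slots on the window.**  At a ring history `P` in comb gauge with `1 − Re(q(w_k))² ≤ ρ²` (`ρ ≥ 0`) and any `ρ′ ≥ ρ + 16L²√F₀(P)` with
`ρ′² ≤ 5/24`: at every wrap link `(i,(x,k))`, `x_k = −1`, the trace of the explicit central field is `≤ 3 − (3/2)/N + 3ρ′²/N`, `N = #wrapBlock k`
(✓`centralDiv_wrap_eq` + ✓`central_trace_le`, inputs ✓`im_wrap_le_of_window`, ✓`blockIm_le_of_window`). [cite: CosteEtAl1985] -/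
theorem centralDiv_wrap_le_of_window {σ : Fin 3 → ℝ} (hσ : ∀ k, σ k = 1 ∨ σ k = -1) (σ₄ : ℝ)
    (P : (Fin (2 * L - 1 + 1) → GaugeConfig 3 L SU2) × (Site 3 L → SU2)) (ht : treeGauge (P.1 0) = 1) {ρ ρ' : ℝ} (hρ : 0 ≤ ρ)
    {k : Fin 3} (hcen : 1 - (su2Quat (wrapReps (P.1 0) k)).re ^ 2 ≤ ρ ^ 2)
    (hρ' : ρ + 16 * (L : ℝ) ^ 2 * Real.sqrt (ringDeficit L (fun _ => false) P) ≤ ρ') (hρ'2 : ρ' ^ 2 ≤ 5 / 24)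
    (i : Fin (2 * L - 1 + 1)) {x : Site 3 L} (hx : x k = -1) :
    ∑ a : Fin 3, frameD (stdFrame (Sum.inl (i, (x, k)), a)) (fun M' => pauliCoord (centralDir L σ σ₄ M' (Sum.inl (i, (x, k)))) a) (ringCoord L P) ≤
      3 - (3 / 2) / ((wrapBlock L k).card : ℝ) + 3 * ρ' ^ 2 / ((wrapBlock L k).card : ℝ) := by
  have hδ0 : 0 ≤ ρ + 16 * (L : ℝ) ^ 2 * Real.sqrt (ringDeficit L (fun _ => false) P) := by positivity
  have hρ'0 : 0 ≤ ρ' := hδ0.trans hρ'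
  have hsq : (ρ + 16 * (L : ℝ) ^ 2 * Real.sqrt (ringDeficit L (fun _ => false) P)) ^ 2 ≤ ρ' ^ 2 := pow_le_pow_left₀ hδ0 hρ' 2
  -- `|z_k|² ≤ ρ′²`
  have hz : (blockIm L (wrapBlock L k) k P 0) ^ 2 + (blockIm L (wrapBlock L k) k P 1) ^ 2 + (blockIm L (wrapBlock L k) k P 2) ^ 2 ≤ ρ' ^ 2 :=
    (blockIm_le_of_window P ht hρ k hcen).trans hsq
  have hzlt : (blockIm L (wrapBlock L k) k P 0) ^ 2 + (blockIm L (wrapBlock L k) k P 1) ^ 2 + (blockIm L (wrapBlock L k) k P 2) ^ 2 < 1 / 2 := by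
    linarith
  -- `|Im q|² ≤ ρ′²`
  obtain ⟨e0, e1, e2⟩ := imVec_apply (su2Quat (P.1 i (x, k)))
  have hp : (imVec (su2Quat (P.1 i (x, k))) 0) ^ 2 + (imVec (su2Quat (P.1 i (x, k))) 1) ^ 2 + (imVec (su2Quat (P.1 i (x, k))) 2) ^ 2 ≤ ρ' ^ 2 := by
    rw [e0, e1, e2]
    have h := le_sq_of_sqrt_le (by positivity) (im_wrap_le_of_window P ht hρ hcen i hx)
    exact h.trans hsq
  have hN : (0 : ℝ) < ((wrapBlock L k).card : ℝ) := Nat.cast_pos.2 (Finset.card_pos.2 (wrapBlock_nonempty k))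
  have key := central_trace_le (σ := σ k) (q₀ := (su2Quat (P.1 i (x, k))).re) (N := ((wrapBlock L k).card : ℝ)) (ρ := ρ')
    (z := blockIm L (wrapBlock L k) k P) (p := imVec (su2Quat (P.1 i (x, k)))) (hσ k) (re_sq_add_imVec_sq _) hp hz (by linarith) hN
  rw [e0, e1, e2] at key
  rw [Fin.sum_univ_three, centralDiv_wrap_eq σ σ₄ P i hx hzlt (fun a => differentiableAt_centralDir_pauliCoord σ σ₄ _ a _)]
  exact key

/-- ★ **Seam slots on the window.**  At a ring history `P` in comb gauge with `1 − Re(q(P.2 0))² ≤ ρ²` (`ρ ≥ 0`) and any `ρ′ ≥ ρ + 16L²√F₀(P)` with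
`ρ′² ≤ 5/24`: at every seam site the trace of the explicit central field is `≤ 3 − (3/2)/L³ + 3ρ′²/L³` (✓`centralDiv_seam_eq` + ✓`central_trace_le`,
inputs ✓`im_seam_le_of_window`, ✓`seamIm_le_of_window`). [cite: CosteEtAl1985] -/
theorem centralDiv_seam_le_of_window (σ : Fin 3 → ℝ) {σ₄ : ℝ} (hσ₄ : σ₄ = 1 ∨ σ₄ = -1)
    (P : (Fin (2 * L - 1 + 1) → GaugeConfig 3 L SU2) × (Site 3 L → SU2)) (ht : treeGauge (P.1 0) = 1) {ρ ρ' : ℝ} (hρ : 0 ≤ ρ)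
    (hcen : 1 - (su2Quat (P.2 0)).re ^ 2 ≤ ρ ^ 2)
    (hρ' : ρ + 16 * (L : ℝ) ^ 2 * Real.sqrt (ringDeficit L (fun _ => false) P) ≤ ρ') (hρ'2 : ρ' ^ 2 ≤ 5 / 24) (x : Site 3 L) :
    ∑ a : Fin 3, frameD (stdFrame (Sum.inr x, a)) (fun M' => pauliCoord (centralDir L σ σ₄ M' (Sum.inr x)) a) (ringCoord L P) ≤
      3 - (3 / 2) / (L : ℝ) ^ 3 + 3 * ρ' ^ 2 / (L : ℝ) ^ 3 := by
  have hs0 : 0 ≤ Real.sqrt (ringDeficit L (fun _ => false) P) := Real.sqrt_nonneg _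
  have hL2 : 0 ≤ (L : ℝ) ^ 2 := by positivity
  have h12 : 0 ≤ ρ + 12 * (L : ℝ) ^ 2 * Real.sqrt (ringDeficit L (fun _ => false) P) := by positivity
  have h12le : ρ + 12 * (L : ℝ) ^ 2 * Real.sqrt (ringDeficit L (fun _ => false) P) ≤ ρ' := by nlinarith
  have hρ'0 : 0 ≤ ρ' := h12.trans h12le
  have hsq : (ρ + 12 * (L : ℝ) ^ 2 * Real.sqrt (ringDeficit L (fun _ => false) P)) ^ 2 ≤ ρ' ^ 2 := pow_le_pow_left₀ h12 h12le 2
  -- `|z₄|² ≤ ρ′²`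
  have hz : (seamIm L P 0) ^ 2 + (seamIm L P 1) ^ 2 + (seamIm L P 2) ^ 2 ≤ ρ' ^ 2 := (seamIm_le_of_window P ht hρ hcen).trans hsq
  have hzlt : (seamIm L P 0) ^ 2 + (seamIm L P 1) ^ 2 + (seamIm L P 2) ^ 2 < 1 / 2 := by linarith
  -- `|Im q|² ≤ ρ′²`
  obtain ⟨e0, e1, e2⟩ := imVec_apply (su2Quat (P.2 x))
  have hp : (imVec (su2Quat (P.2 x)) 0) ^ 2 + (imVec (su2Quat (P.2 x)) 1) ^ 2 + (imVec (su2Quat (P.2 x)) 2) ^ 2 ≤ ρ' ^ 2 := by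
    rw [e0, e1, e2]
    have h := le_sq_of_sqrt_le (by positivity) (im_seam_le_of_window P ht hρ hcen x)
    exact h.trans hsq
  have hN : (0 : ℝ) < (L : ℝ) ^ 3 := by
    have : (0 : ℝ) < L := Nat.cast_pos.2 (NeZero.pos L)
    positivity
  have key := central_trace_le (σ := σ₄) (q₀ := (su2Quat (P.2 x)).re) (N := (L : ℝ) ^ 3) (ρ := ρ')
    (z := seamIm L P) (p := imVec (su2Quat (P.2 x))) hσ₄ (re_sq_add_imVec_sq _) hp hz (by linarith) hN
  rw [e0, e1, e2] at key
  rw [Fin.sum_univ_three, centralDiv_seam_eq σ σ₄ P x hzlt (fun a => differentiableAt_centralDir_pauliCoord σ σ₄ _ a _)]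
  exact key

/-- Plain slots: `≤ 3` (✓`centralDiv_plain_le`, differentiability discharged). [folklore] -/
theorem centralDiv_plain_le' (σ : Fin 3 → ℝ) (σ₄ : ℝ) (P : (Fin (2 * L - 1 + 1) → GaugeConfig 3 L SU2) × (Site 3 L → SU2))
    (i : Fin (2 * L - 1 + 1)) (e : Edge 3 L) (htree : ¬(i = 0 ∧ treeEdge e = true)) (hx : ¬ e.1 e.2 = -1) :
    ∑ a : Fin 3, frameD (stdFrame (Sum.inl (i, e), a)) (fun M' => pauliCoord (centralDir L σ σ₄ M' (Sum.inl (i, e))) a) (ringCoord L P) ≤ 3 := by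
  rw [Fin.sum_univ_three]
  exact centralDiv_plain_le σ σ₄ P i e htree hx (fun a => differentiableAt_centralDir_pauliCoord σ σ₄ _ a _)

/-! ## §3 The total on the window -/

/-- ★★ **The central divergence on the window, at a ring history in comb gauge**: with the three wrap masses and the seam-root mass `≤ ρ²` (`ρ ≥ 0`)
and `ρ′ ≥ ρ + 16L²√F₀(P)`, `ρ′² ≤ 5/24`:  `Σ_va ∂_{fixFrameStd va}(centralCoeff L σ σ₄ va)(ringCoord P) ≤ 18L⁴ − ½`
(per-slot bounds of §2 into w2's ✓`centralDiv_le_budget`). [cite: CosteEtAl1985] -/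
theorem centralDiv_le_of_window {σ : Fin 3 → ℝ} (hσ : ∀ k, σ k = 1 ∨ σ k = -1) {σ₄ : ℝ} (hσ₄ : σ₄ = 1 ∨ σ₄ = -1)
    (P : (Fin (2 * L - 1 + 1) → GaugeConfig 3 L SU2) × (Site 3 L → SU2)) (ht : treeGauge (P.1 0) = 1) {ρ ρ' : ℝ} (hρ : 0 ≤ ρ)
    (hk : ∀ k : Fin 3, 1 - (su2Quat (wrapReps (P.1 0) k)).re ^ 2 ≤ ρ ^ 2) (hs : 1 - (su2Quat (P.2 0)).re ^ 2 ≤ ρ ^ 2)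
    (hρ' : ρ + 16 * (L : ℝ) ^ 2 * Real.sqrt (ringDeficit L (fun _ => false) P) ≤ ρ') (hρ'2 : ρ' ^ 2 ≤ 5 / 24) :
    ∑ va : FixVar L × Fin 3, frameD (fixFrameStd va) (centralCoeff L σ σ₄ va) (ringCoord L P) ≤ 18 * (L : ℝ) ^ 4 - 1 / 2 :=
  (centralDiv_le_budget σ σ₄ (ringCoord L P) ρ'
    (fun i _ k hx => centralDiv_wrap_le_of_window hσ σ₄ P ht hρ (hk k) hρ' hρ'2 i hx)
    (fun i e htree hx => centralDiv_plain_le' σ σ₄ P i e htree hx)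
    (fun x => centralDiv_seam_le_of_window σ hσ₄ P ht hρ hs hρ' hρ'2 x)).2 hρ'2

/-! ## §4 (P3) in package shape -/

/-- ★★★ **(P3) FOR THE EXPLICIT CENTRAL FIELD, PACKAGE SHAPE.**  For signs `σ_k, σ₄ = ±1`, a radius `0 ≤ ρ ≤ 1/5` and a window `t_C ≤ (4096·L⁴)⁻¹`:
at every point `x` of `X_fix` whose three wrap masses and seam-root mass are `≤ ρ²` and with `F_fix x ≤ t_C`,
`Σ_va ∂_{fixFrameStd va}(centralCoeff L σ σ₄ va)(M_x) ≤ 18·L⁴ − ½` — the second conjunct of the central package of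
✓`periodicSoftness_of_signPlug` for `Φ = centralCoeff L` (no sign hypothesis needed).  `ρ′ = 9/20`: `16L²√F_fix ≤ 1/4` (✓`sixteen_sq_sqrt_le`),
`(9/20)² ≤ 5/24`. [cite: CosteEtAl1985] [cite: Luscher1983, §2] -/
theorem central_divergence_window {σ : Fin 3 → ℝ} (hσ : ∀ k, σ k = 1 ∨ σ k = -1) {σ₄ : ℝ} (hσ₄ : σ₄ = 1 ∨ σ₄ = -1)
    (x : (OffIdx L → SU2) × ((Fin (2 * L - 1) → GaugeConfig 3 L SU2) × (Site 3 L → SU2))) {ρ t_C : ℝ} (hρ0 : 0 ≤ ρ) (hρ5 : ρ ≤ 1 / 5)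
    (htC : t_C ≤ (4096 * (L : ℝ) ^ 4)⁻¹)
    (hk : ∀ k : Fin 3, 1 - (su2Quat (wrapReps ((Fin.cons (glue x.1) x.2.1 : Fin (2 * L - 1 + 1) → GaugeConfig 3 L SU2) 0) k)).re ^ 2 ≤ ρ ^ 2)
    (hs : 1 - (su2Quat (x.2.2 0)).re ^ 2 ≤ ρ ^ 2)
    (hF : ringDeficit L (fun _ => false) ((Fin.cons (glue x.1) x.2.1 : Fin (2 * L - 1 + 1) → GaugeConfig 3 L SU2), x.2.2) ≤ t_C) :
    ∑ va, frameD (fixFrameStd va) (centralCoeff L σ σ₄ va) (ringCoord L ((Fin.cons (glue x.1) x.2.1 : Fin (2 * L - 1 + 1) → GaugeConfig 3 L SU2), x.2.2)) ≤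
      18 * (L : ℝ) ^ 4 - 1 / 2 := by
  set P : (Fin (2 * L - 1 + 1) → GaugeConfig 3 L SU2) × (Site 3 L → SU2) :=
    ((Fin.cons (glue x.1) x.2.1 : Fin (2 * L - 1 + 1) → GaugeConfig 3 L SU2), x.2.2) with hPdef
  have hP0 : P.1 0 = glue x.1 := by simp [hPdef]
  have ht : treeGauge (P.1 0) = 1 := by rw [hP0]; funext y; exact treeGauge_glue x.1 y
  have hL1 : (1 : ℝ) ≤ L := by exact_mod_cast NeZero.one_le
  have hd : 16 * (L : ℝ) ^ 2 * Real.sqrt (ringDeficit L (fun _ => false) P) ≤ 1 / 4 := sixteen_sq_sqrt_le hL1 (hF.trans htC)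
  obtain ⟨hρ', hρ'2⟩ := rho_prime_sq_le hρ5 hd
  have hs' : 1 - (su2Quat (P.2 0)).re ^ 2 ≤ ρ ^ 2 := hs
  exact centralDiv_le_of_window hσ hσ₄ P ht hρ0 hk hs' hρ' hρ'2

end Summit.QuantumFields.YangMills.Theorems.VirialFluxGap.CentralField

end
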